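import Mathlib
import Literature.MathematicalPhysics.QuantumFieldTheory.MagnenRivasseauSeneor1993.MRS93AxialYMAction
import HarnessLib

/-!
# Magnen–Rivasseau–Sénéor (CMP 155, 1993): (II.18)–(II.19) as an identity of MEASURES on cut-off configurations —
# `dμ_{0,ρ₁}(A) e^{−(1/2)⟨A,p₀²A⟩} = Z · dμ_{axial,ρ₁}(A)` («which is proportional to dμ_{axial,ρ₁}(A) … the Gaussian
# measure dμ_axial and propagators C_axial are obtained by joining to C₀ the quadratic piece ⟨A, p₀²A⟩», p.332),
# PROVED on every symmetric momentum window, with the proportionality constant `Z` explicit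

statement-level skeleton of published definitions with citation tags; bookkeeping proved; nothing here is a claim
about the Yang–Mills mass gap, about continuum Yang–Mills on `T⁴` without infrared cutoff, or about the Clay problem —
and nothing of Magnen–Rivasseau–Sénéor's analysis is asserted or formalised

**Citation header (reproduction of PUBLISHED work).** J. Magnen, V. Rivasseau, R. Sénéor, *Construction of YM₄ with
an infrared cutoff*, Commun. Math. Phys. **155** (1993) 325–383 [MagnenRivasseauSeneor1993], Sect. II.A p.332
((II.16)–(II.19)) and (II.78) p.347. Loci `p.NNN tl.nn` = journal page / text-layer line of the held scan
`paper:magnen1993-cmp155-mrs-ym4-infrared-cutoff` (PDF page = journal page − 324); the displays (II.16)–(II.19) re-read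
on the decoded page image (renders of record `run/shared/lean/pub/lit-balaban/inprint/lit-balaban-p14/renders-cmp155/
p08_full_s6.png`; 2× crops `run/shared/lean/pub/pub-balaban-gaps/pub-balaban-gaps-mrs-lit-1/g3/renders/
p08_crop_r450-2700_s2.png`, `p08_crop_r2700-3500_s2.png`). Cell pub-balaban-gaps, track G3, seat mrs-lit-1 (gen 4);
companion prose `run/shared/lean/pub/pub-balaban-gaps/g3/MRS-AS-PRINTED.md` §2, §5. Builds on
`…MRS93GaussianReferenceMeasures` (`muZero par ρ₁ = dμ_{0,ρ₁}(A)`: the realified countable product `gaussianFieldLaw` of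
centred Gaussian modes `modeGaussian`, `rep`, `sgn`, `realify`, `Parameters.muZeroVariance`) and `…MRS93AxialYMAction`
(`quadTime S = ⟨A,p₀²A⟩`, `quadForm S w = ⟨A,w(p)A⟩`, `Fsp`, `quadSlices`, `ymFactor` = the third factor of (II.78);
§10 there: the ONE-MODE tilting lemma `gaussianReal_withDensity_exp_neg_half_mul_sq`).

**Why this file.** Gen 3 kernel-checked the printed sentence p.332 tl.18–23 MODE BY MODE (one real coordinate of
`dμ_{0,ρ₁}` tilted by its share of `e^{−(1/2)⟨A,p₀²A⟩}` is, up to a constant, the centred Gaussian with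
`C_axial(p)⁻¹ = p₀² + C₀(p)⁻¹`) and left the assembly over the modes of a window open («a finite product of such tilts
times the untouched modes — is not carried out here», `muZeroVariance_tilt_eq_axial`). This file carries it out: the
general measure-theoretic fact (§1: tilting finitely many coordinates of an infinite product of probability
measures, proved from Mathlib's `Measure.eq_infinitePi`, `iIndepFun_infinitePi`), the one-mode tilt uniformly in the
variance (§2: including the degenerate modes of variance `0` — the time components `A₀ = 0` of the axial field and
the modes beyond the fake cutoff — where the tilt is trivial), the quadratic form `⟨A, w(p)A⟩` of a REAL field on a
symmetric window as a sum over independent coordinates (§4), and then (II.18)/(II.19) as printed, as identities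
between measures on `Config` (§6–§7).

**What the paper prints (verbatim, from the page image p.332).** tl.16–26: *«We could write instead of (II.17) the
functional measure of the theory as: dμ_{0,ρ₁}(A) e^{(1/2)(−F²_sp − ⟨A,p₀²A⟩ + Σ_i(λ_i^t)²⟨A,(p²κ^i(p))A⟩)} which is
proportional to dμ_{axial,ρ₁}(A) e^{(1/2)(−F²_sp + Σ_i(λ_i^t)²⟨A,(p²κ^i(p))A⟩)}, (II.18) where dμ_{0,ρ₁} is the
Gaussian measure with propagator C₀(p)κ_{ρ₁}(p), and the sum over i in (II.18) stops at ρ₁, and the Gaussian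
measure dμ_axial and propagators C_axial are obtained by joining to C₀ the quadratic piece ⟨A, p₀²A⟩: ⟨A, p₀²A⟩ +
Σ_i(λ_i^t)²⟨Ap²κ^i(p)A⟩ = ⟨A, C_axial⁻¹A⟩. (II.19) This formula is still formal, because the positive exponential
cannot be integrated simply with the Gaussian measure dμ_{0,ρ₁} (this would give back the ill-defined Lebesgue
measure).»*; (II.78) p.347 tl.2–7, first and third line: *«Σ_LFR ∫ dμ_{0,ρ₁}(A′)dν_{ρ₂}(γ) … ×
e^{(1/2)(−F²_sp(A) − ⟨A,p₀²A⟩ + Σ_i λ²⟨A,(p²κ^i(p))A⟩)} …»*.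

**What is typed here (definitions with bodies; everything else PROVED; zero `sorry`, zero named facts).**
* §1 (generic measure theory, any index type) `withDensity_map_eq` (`(g_*μ)·F = g_*(μ·(F∘g))`),
  `lintegral_finset_prod_eval_infinitePi` (`∫ Π_{i∈J} g_i(x_i) d(⊗_i μ_i) = Π_{i∈J} ∫ g_i dμ_i`), and
  **`infinitePi_withDensity_finset_prod`**: if `(μ_i)·f_i = Z_i ν_i` for `i ∈ I` (finite), `0 < Z_i < ∞`, `ν_i`
  probability measures, then `(⊗_i μ_i)·(Π_{i∈I} f_i(x_i)) = (Π_{i∈I} Z_i) ⊗_i μ′_i` with `μ′_i = ν_i` on `I`, `μ_i`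
  off `I`.
* §2 the one-mode tilt UNIFORMLY in the variance `v ≥ 0`: `tiltVar v c = v/(1 + cv)` (`= (v⁻¹ + c)⁻¹` for `v > 0`,
  `= 0` for `v = 0`), `tiltNorm v c = (1 + cv)^{−1/2}`, and `𝒩(0,v)·e^{−cx²/2} = tiltNorm v c · 𝒩(0, tiltVar v c)`
  (`gaussianReal_withDensity_exp_neg_half_mul_sq_eq_tilt`; `v = 0`: a Dirac mode is untouched).
* §3 `modeGaussian_withDensity_prod`: tilting finitely many independent Gaussian modes.
* §4 the positive half `posWindow S` of a window (representatives of the pairs `±p`), `posModes S` (its real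
  coordinates), and **`quadForm_realify`**: on a SYMMETRIC window (`p ∈ S ⇒ −p ∈ S`) and for an even symbol `w`, the
  form `⟨A, w(p)A⟩ = (1/2)Σ_{p∈S} w(p)Σ_{μ,a}|Ã^a_μ(p)|²` of a real configuration is `Σ_{m ∈ posModes S} w(p_m) X_m²` in
  the independent coordinates `X` (the two members of a pair `±p` contribute equally: `Ã(−p) = conj Ã(p)`).
* §5 `gaussianFieldLaw_congr_of_isPos` (the realified law only sees the variances at the representatives) and
  **`gaussianFieldLaw_withDensity_exp_neg_half_quadForm`**: for any real Gaussian field law with mode variances `v`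
  and any even nonnegative symbol `w`, `(law v)·e^{−(1/2)⟨A,w(p)A⟩_S} = (Π_{m∈posModes S} tiltNorm(v_m, w(p_m))) · law v_w`
  with `v_w(m) = tiltVar(v_m, w(p_m))` on the window and `v_m` off it — «joining to the propagator the quadratic piece
  ⟨A, w(p)A⟩» as a theorem about measures.
* §6 THE PRINTED OBJECTS: `cTime p = p₀²`; **`Parameters.axialVariance par ρ₁ S`** (the mode variances of
  `dμ_{axial,ρ₁}` on the window `S`: `C₀κ_{ρ₁}/(1 + p₀²C₀κ_{ρ₁})` on `S`, time components `0`, untouched off `S`);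
  **`muAxial par ρ₁ S : Measure Config`** = `dμ_{axial,ρ₁}(A)` (a probability measure); **`axialNorm par ρ₁ S`** = the
  proportionality constant `Z = Π_{m∈posModes S}(1 + p₀²v_m)^{−1/2}` (`0 < Z ≤ 1`); and the theorems
  **`muZero_withDensity_exp_neg_half_quadTime`**: `dμ_{0,ρ₁}(A)·e^{−(1/2)⟨A,p₀²A⟩_S} = Z · dμ_{axial,ρ₁}(A)` — the
  window-product ASSEMBLY gen 3 left open —, `lintegral_exp_neg_half_quadTime_muZero` (`Z` IS the integral
  `∫e^{−(1/2)⟨A,p₀²A⟩}dμ_{0,ρ₁}`), and **(II.18) AS PRINTED, `muZero_withDensity_ymFactor`**: `dμ_{0,ρ₁}(A)·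
  e^{(1/2)(−F²_sp−⟨A,p₀²A⟩+Σ_i(λ_i^t)²⟨A,(p²κ^i(p))A⟩)} = Z · dμ_{axial,ρ₁}(A)·e^{(1/2)(−F²_sp+Σ_i(λ_i^t)²⟨A,(p²κ^i(p))A⟩)}`
  as measures on `Config` — finite or not: `…AxialYMAction` §7 shows that the POSITIVE EXPONENTIAL
  `e^{(1/2)Σ_i(λ_i^t)²⟨A,(p²κ^i(p))A⟩}` ALONE is not `dμ_{0,ρ₁}`-integrable («still formal»); whether the complete
  right-hand side of (II.18) is a finite measure is NOT decided here.
* §7 **(II.19) for the assembled measure**: on a spatial mode of the window on the plateau of the fake cutoff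
  (`κ_{ρ₁}(|p|) = 1`, `C₀(p)⁻¹ > 0`) the variance of `dμ_{axial,ρ₁}` is `(p₀² + C₀(p)⁻¹)⁻¹ = C_axial(p)`
  (`axialVariance_eq_inv_invCaxial`, and `_eq_ansatz`: the tree's symbol `Ansatz.invCaxial`); `dμ_{axial,ρ₁}` is
  still axial (`axialVariance_of_isTime`), even under `p ↦ −p`, and its two-point function is computed
  (`integral_sq_muAxial`); (v1.1) `axialVariance_eq_inv_invCaxial_of_le` (the whole plateau `|p| ≤ M^{ρ₁}`),
  `axialVariance_eq_zero_of_ge` (dead modes beyond the fake cutoff); §7b (v1.1) the AXIAL REFERENCE MODEL `axialRefModel`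
  (`PinnedTheory` with law `dμ_{axial,ρ₁(ρ)}` on the canonical window): still axial, two-point function = the axial
  propagator, **ultraviolet limit EXISTS** (`axialRefModel_uvLimit`, mode-wise eventually constant variances).
* §8 the same assembly for the TRUE-CUTOFF factor `e^{−(1/2)⟨A′,[(κ_ρ)⁻¹−1](p²)A′⟩}` (second line of (II.78);
  (II.40)): `Parameters.trueCutoffSymbol`, and **`muZeroPrime_withDensity_exp_neg_half_trueCutoff`** — on every
  symmetric window on which the true cutoff is alive (`κ_ρ > 0`), `dμ_{0,ρ₁}(A′)·e^{−(1/2)⟨A′,[(κ_ρ)⁻¹−1](p²)A′⟩_S}` IS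
  (an explicit constant times) the real Gaussian field law whose variances on the window are the symbol
  `Parameters.trueCutoffCovariance` that `…GaussianReferenceMeasures` §6 DECLARED («OUR one-line Gaussian algebra»)
  — now a theorem (`tiltVar_eq_trueCutoffVariance`).

**Readings (declared).** Those of `…AxialYMAction` ((P) Parseval at unit volume, (S) windows) and of
`…GaussianReferenceMeasures` ((vi) normalisation of the real/imaginary parts, half-lattice of representatives — ours).
(U) «dμ_{axial,ρ₁}»: the print DEFINES `dμ_axial`, `C_axial` by the words «obtained by joining to C₀ the quadratic
piece ⟨A, p₀²A⟩» and the display (II.19), in which `C₀⁻¹ = Σ_i(λ_i^t)²p²κ^i(p)` ((II.16)) carries no `κ_{ρ₁}`; the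
measure that makes (II.18) an IDENTITY is the Gaussian obtained by joining `⟨A,p₀²A⟩` to the propagator
`C₀(p)κ_{ρ₁}(p)` OF `dμ_{0,ρ₁}` — mode variance `v/(1 + p₀²v)` with `v = C₀κ_{ρ₁}` (`Parameters.axialVariance`) —, which
is `(p₀² + C₀(p)⁻¹)⁻¹ = C_axial(p)` exactly where `κ_{ρ₁}(|p|) = 1` (all `|p| ≤ M^{ρ₁}`, §7) and `0` where `κ_{ρ₁} = 0`;
in the shell `M^{ρ₁} < |p| < (3 + η⁻¹)M^{ρ₁}` it is `(p₀² + (C₀κ_{ρ₁})⁻¹)⁻¹`, which is what «proportional» forces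
and what we take «dμ_{axial,ρ₁}» to denote (the print does not spell the subscript `ρ₁` of `dμ_{axial,ρ₁}` out
further). (V) the window `S` must be symmetric under `p ↦ −p` (the canonical windows `window R` are,
`neg_mem_window_iff`): the modes of `dμ_{0,ρ₁}` off `S` are untouched by `e^{−(1/2)⟨A,p₀²A⟩_S}`.

**Honest status / what is NOT claimed.** This proves the Gaussian bookkeeping sentence of p.332 tl.18–23 for the
typed reference measure and the typed action factor, with its constant (and its true-cutoff analogue on live
windows; the suppression of the modes where `κ_ρ = 0`, where the printed symbol is `+∞`, is not a tilt by a real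
density and is not claimed); it does NOT make (II.18) a finite measure
(`…AxialYMAction` §7 proves the opposite for its positive exponential — «This formula is still formal»), it computes
no moment of MRS's interacting theory, it does not touch the other factors of (II.78) (`χ_LFR`, `G`, `K_{ρ,ρ₂}`,
`CT_ρ`, `L_{0,ρ₁}F`, the gauge-fixing factor, the γ-damping, the change of variables `A = T⁻¹(A′ − U(γ))`), and
`PinnedTheory.law` stays an assumption. Nothing here is continuum Yang–Mills on `T⁴`, nothing lifts the infrared
cutoff, nothing is about Bałaban's programme.
-/

noncomputable section

open MeasureTheory ProbabilityTheory Filter Topology Finset Complex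
open scoped NNReal ENNReal ComplexConjugate

namespace Literature.MathematicalPhysics.QuantumFieldTheory.MagnenRivasseauSeneor1993

namespace MainStatement

open Ansatz

/-! ## §1 Generic: tilting finitely many coordinates of an infinite product of probability measures -/

section generic

variable {ι : Type*} {X : ι → Type*} [∀ i, MeasurableSpace (X i)]

/-- `withDensity` commutes with push-forward along a measurable map: `(g_* μ)·F = g_*(μ·(F ∘ g))` (used to pass
the tilt through the realification map of `…GaussianReferenceMeasures`).
[cite: MagnenRivasseauSeneor1993, (II.18) p.332 tl.16–23] -/
theorem withDensity_map_eq {α β : Type*} [MeasurableSpace α] [MeasurableSpace β] (μ : Measure α)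
    {g : α → β} (hg : Measurable g) {F : β → ℝ≥0∞} (hF : Measurable F) :
    (μ.map g).withDensity F = (μ.withDensity (F ∘ g)).map g := by
  ext s hs
  rw [withDensity_apply _ hs, Measure.map_apply hg hs, withDensity_apply _ (hg hs),
    setLIntegral_map hs hF hg]
  rfl

/-- The integral of a finite product of one-coordinate functions against an infinite product of probability
measures is the product of the one-coordinate integrals (independence of the coordinates, Mathlib
`iIndepFun_infinitePi`). [cite: MagnenRivasseauSeneor1993, (II.18) p.332 tl.16–23] -/
theorem lintegral_finset_prod_eval_infinitePi (μ : ∀ i, Measure (X i)) [∀ i, IsProbabilityMeasure (μ i)]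
    (J : Finset ι) {g : ∀ i, X i → ℝ≥0∞} (hg : ∀ i, Measurable (g i)) :
    ∫⁻ x, ∏ i ∈ J, g i (x i) ∂(Measure.infinitePi μ) = ∏ i ∈ J, ∫⁻ y, g i y ∂(μ i) := by
  have hind : iIndepFun (fun i (x : ∀ j, X j) => g i (x i)) (Measure.infinitePi μ) :=
    iIndepFun_infinitePi (P := μ) (X := g) hg
  have h := lintegral_prod_eq_prod_lintegral_of_indepFun J (fun i (x : ∀ j, X j) => g i (x i)) hind
    (fun i => (hg i).comp (measurable_pi_apply i))
  rw [h]
  refine Finset.prod_congr rfl fun i _ => ?_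
  exact (measurePreserving_eval_infinitePi μ i).lintegral_comp (hg i)

/-- **Tilting finitely many coordinates of an infinite product of probability measures.** If on each coordinate
`i ∈ I` (finite) the tilted law `(μ i)·f i` is `Z i` times a probability measure `ν i` with `0 < Z i < ∞`, then
tilting the product measure `⊗_i μ i` by `Π_{i∈I} f i (x i)` gives `(Π_{i∈I} Z i)` times the product measure with the
laws `ν i` on `I` and `μ i` elsewhere (both sides take the same values on measurable boxes: `Measure.eq_infinitePi`).
[cite: MagnenRivasseauSeneor1993, (II.18) p.332 tl.16–23] -/
theorem infinitePi_withDensity_finset_prod [DecidableEq ι] (μ ν : ∀ i, Measure (X i))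
    [∀ i, IsProbabilityMeasure (μ i)] [∀ i, IsProbabilityMeasure (ν i)]
    (I : Finset ι) {f : ∀ i, X i → ℝ≥0∞} (hf : ∀ i, Measurable (f i)) (Z : ι → ℝ≥0∞)
    (hZ0 : ∀ i ∈ I, Z i ≠ 0) (hZtop : ∀ i ∈ I, Z i ≠ ⊤)
    (hν : ∀ i ∈ I, (μ i).withDensity (f i) = Z i • ν i) :
    (Measure.infinitePi μ).withDensity (fun x => ∏ i ∈ I, f i (x i)) =
      (∏ i ∈ I, Z i) • Measure.infinitePi (fun i => if i ∈ I then ν i else μ i) := by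
  set μ' : ∀ i, Measure (X i) := fun i => if i ∈ I then ν i else μ i with hμ'
  haveI hprob : ∀ i, IsProbabilityMeasure (μ' i) := fun i => by
    by_cases hi : i ∈ I
    · rw [hμ']; simp only [if_pos hi]; infer_instance
    · rw [hμ']; simp only [if_neg hi]; infer_instance
  have hZt0 : ∏ i ∈ I, Z i ≠ 0 := Finset.prod_ne_zero_iff.mpr hZ0
  have hZttop : ∏ i ∈ I, Z i ≠ ⊤ := ENNReal.prod_ne_top hZtop
  -- the values of the tilted measure on measurable boxes
  have key : ∀ (s : Finset ι) (t : ∀ i, Set (X i)), (∀ i, MeasurableSet (t i)) →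
      (Measure.infinitePi μ).withDensity (fun x => ∏ i ∈ I, f i (x i)) (Set.pi s t) =
        (∏ i ∈ I, Z i) * ∏ i ∈ s, μ' i (t i) := by
    intro s t ht
    have hst : MeasurableSet (Set.pi (s : Set ι) t) :=
      MeasurableSet.pi s.countable_toSet fun i _ => ht i
    rw [withDensity_apply _ hst, ← lintegral_indicator hst]
    set g : ∀ i, X i → ℝ≥0∞ := fun i y =>
      (if i ∈ I then f i y else 1) * (if i ∈ s then (t i).indicator 1 y else 1) with hg
    have hgm : ∀ i, Measurable (g i) := by
      intro i
      by_cases hi : i ∈ I <;> by_cases his : i ∈ s <;>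
        simp only [hg, hi, his, if_true, if_false, one_mul, mul_one]
      · exact (hf i).mul (measurable_one.indicator (ht i))
      · exact hf i
      · exact measurable_one.indicator (ht i)
      · exact measurable_const
    have hptw : ∀ x, (Set.pi (s : Set ι) t).indicator (fun x => ∏ i ∈ I, f i (x i)) x =
        ∏ i ∈ I ∪ s, g i (x i) := by
      intro x
      by_cases hx : x ∈ Set.pi (s : Set ι) t
      · rw [Set.indicator_of_mem hx]
        have h1 : ∀ i ∈ I ∪ s, g i (x i) = if i ∈ I then f i (x i) else 1 := by
          intro i _
          have h2 : (if i ∈ s then (t i).indicator (1 : X i → ℝ≥0∞) (x i) else 1) = 1 := by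
            split_ifs with his
            · exact Set.indicator_of_mem (hx i (Finset.mem_coe.mpr his)) _
            · rfl
          simp only [hg]
          rw [h2, mul_one]
        rw [Finset.prod_congr rfl h1, Finset.prod_ite_mem, Finset.union_inter_cancel_left]
      · rw [Set.indicator_of_notMem hx]
        obtain ⟨i, hi, hxi⟩ : ∃ i, i ∈ (s : Set ι) ∧ x i ∉ t i := by
          by_contra hcon
          push Not at hcon
          exact hx hcon
        symm
        refine Finset.prod_eq_zero (Finset.mem_union_right I (Finset.mem_coe.mp hi)) ?_
        simp only [hg]
        rw [if_pos (Finset.mem_coe.mp hi), Set.indicator_of_notMem hxi, mul_zero]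
    simp_rw [hptw]
    rw [lintegral_finset_prod_eval_infinitePi μ (I ∪ s) hgm]
    have hone : ∀ i, ∫⁻ y, g i y ∂μ i =
        (if i ∈ I then Z i else 1) * (if i ∈ s then μ' i (t i) else 1) := by
      intro i
      by_cases hi : i ∈ I <;> by_cases his : i ∈ s <;>
        simp only [hg, hμ', hi, his, if_true, if_false, one_mul, mul_one]
      · have h3 : (fun y => f i y * (t i).indicator 1 y) = (t i).indicator (f i) := by
          funext y
          by_cases hy : y ∈ t i
          · rw [Set.indicator_of_mem hy, Set.indicator_of_mem hy, Pi.one_apply, mul_one]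
          · rw [Set.indicator_of_notMem hy, Set.indicator_of_notMem hy, mul_zero]
        rw [h3, lintegral_indicator (ht i), ← withDensity_apply _ (ht i), hν i hi, Measure.smul_apply,
          smul_eq_mul]
      · rw [← setLIntegral_univ, ← withDensity_apply _ MeasurableSet.univ, hν i hi, Measure.smul_apply,
          smul_eq_mul, measure_univ, mul_one]
      · exact lintegral_indicator_one (ht i)
      · rw [lintegral_const, measure_univ, mul_one]
    simp_rw [hone]
    rw [Finset.prod_mul_distrib, Finset.prod_ite_mem, Finset.prod_ite_mem, Finset.union_inter_cancel_left,
      Finset.union_inter_cancel_right]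
  have h1 : (∏ i ∈ I, Z i)⁻¹ • (Measure.infinitePi μ).withDensity (fun x => ∏ i ∈ I, f i (x i)) =
      Measure.infinitePi μ' := by
    refine Measure.eq_infinitePi μ' fun s t ht => ?_
    rw [Measure.smul_apply, smul_eq_mul, key s t ht, ← mul_assoc, ENNReal.inv_mul_cancel hZt0 hZttop,
      one_mul]
  rw [← h1, smul_smul, ENNReal.mul_inv_cancel hZt0 hZttop, one_smul]

end generic

/-! ## §2 One real mode, uniformly in the variance: `𝒩(0,v)·e^{−cx²/2} = (1+cv)^{−1/2} · 𝒩(0, v/(1+cv))` -/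

/-- THE TILTED VARIANCE `v/(1 + cv)`: `(v⁻¹ + c)⁻¹` for `v > 0` («joining to C₀ the quadratic piece»: `C_axial⁻¹ = p₀² +
C₀⁻¹` with `c = p₀²`, (II.19)), and `0` for a degenerate mode `v = 0` (a Dirac mode stays Dirac).
[cite: MagnenRivasseauSeneor1993, (II.19) p.332 tl.21–23] -/
def tiltVar (v c : ℝ≥0) : ℝ≥0 := v / (1 + c * v)

/-- THE ONE-MODE PROPORTIONALITY CONSTANT `(1 + cv)^{−1/2}` (`= √(v′/v)` for `v > 0`, `v′` the tilted variance).
[cite: MagnenRivasseauSeneor1993, (II.18) p.332 tl.18–19 («which is proportional to»)] -/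
def tiltNorm (v c : ℝ≥0) : ℝ≥0∞ := ENNReal.ofReal ((Real.sqrt (1 + c * v))⁻¹)

/-- A Dirac mode stays Dirac. [cite: MagnenRivasseauSeneor1993, (II.19) p.332] -/
@[simp] theorem tiltVar_zero_left (c : ℝ≥0) : tiltVar 0 c = 0 := by simp [tiltVar]

/-- No tilt, no change. [cite: MagnenRivasseauSeneor1993, (II.19) p.332] -/
@[simp] theorem tiltVar_zero_right (v : ℝ≥0) : tiltVar v 0 = v := by simp [tiltVar]

/-- For a non-degenerate mode the tilted variance is `(v⁻¹ + c)⁻¹` — the printed «joining»: inverse propagators add.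
[cite: MagnenRivasseauSeneor1993, (II.19) p.332 tl.21–23] -/
theorem coe_tiltVar {v : ℝ≥0} (hv : v ≠ 0) (c : ℝ≥0) :
    ((tiltVar v c : ℝ≥0) : ℝ) = (((v : ℝ))⁻¹ + c)⁻¹ := by
  have hv' : (v : ℝ) ≠ 0 := by exact_mod_cast hv
  have hpos : (0 : ℝ) < 1 + c * v := by positivity
  unfold tiltVar
  push_cast
  field_simp

/-- The tilted variance is at most the original one. [cite: MagnenRivasseauSeneor1993, (II.19) p.332] -/
theorem tiltVar_le (v c : ℝ≥0) : tiltVar v c ≤ v := by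
  unfold tiltVar
  exact div_le_self (by positivity) (le_add_of_nonneg_right (by positivity))

/-- The constant is positive … [cite: MagnenRivasseauSeneor1993, (II.18) p.332] -/
theorem tiltNorm_ne_zero (v c : ℝ≥0) : tiltNorm v c ≠ 0 := by
  unfold tiltNorm
  rw [Ne, ENNReal.ofReal_eq_zero, not_le]
  exact inv_pos.mpr (Real.sqrt_pos.mpr (by positivity))

/-- … finite … [cite: MagnenRivasseauSeneor1993, (II.18) p.332] -/
theorem tiltNorm_ne_top (v c : ℝ≥0) : tiltNorm v c ≠ ⊤ := ENNReal.ofReal_ne_top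

/-- … and at most `1` (a tilt by `e^{−cx²/2} ≤ 1` loses mass). [cite: MagnenRivasseauSeneor1993, (II.18) p.332] -/
theorem tiltNorm_le_one (v c : ℝ≥0) : tiltNorm v c ≤ 1 := by
  unfold tiltNorm
  rw [← ENNReal.ofReal_one]
  refine ENNReal.ofReal_le_ofReal (inv_le_one_of_one_le₀ ?_)
  rw [Real.le_sqrt' one_pos, one_pow]
  exact le_add_of_nonneg_right (by positivity)

/-- A Dirac mode loses no mass. [cite: MagnenRivasseauSeneor1993, (II.18) p.332] -/
@[simp] theorem tiltNorm_zero_left (c : ℝ≥0) : tiltNorm 0 c = 1 := by simp [tiltNorm]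

/-- No tilt loses no mass. [cite: MagnenRivasseauSeneor1993, (II.18) p.332] -/
@[simp] theorem tiltNorm_zero_right (v : ℝ≥0) : tiltNorm v 0 = 1 := by simp [tiltNorm]

/-- **Gaussian tilting, one real mode, every variance `v ≥ 0`.** `𝒩(0,v)·e^{−cx²/2} = tiltNorm v c · 𝒩(0, tiltVar v c)`
as measures: for `v > 0` this is `gaussianReal_withDensity_exp_neg_half_mul_sq` of `…AxialYMAction` §10 (densities
`(2πv)^{−1/2}e^{−x²/2v}e^{−cx²/2} = √(v′/v)(2πv′)^{−1/2}e^{−x²/2v′}`); for `v = 0` the mode is the Dirac mass at `0`, on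
which the density is `e⁰ = 1`. [cite: MagnenRivasseauSeneor1993, (II.18)–(II.19) p.332 tl.16–23] -/
theorem gaussianReal_withDensity_exp_neg_half_mul_sq_eq_tilt (v c : ℝ≥0) :
    (gaussianReal 0 v).withDensity (fun x => ENNReal.ofReal (Real.exp (-((c : ℝ) / 2) * x ^ 2))) =
      tiltNorm v c • gaussianReal 0 (tiltVar v c) := by
  by_cases hv : v = 0
  · subst hv
    rw [tiltVar_zero_left, tiltNorm_zero_left, gaussianReal_zero_var, dirac_withDensity, one_smul]
    simp
  · rw [gaussianReal_withDensity_exp_neg_half_mul_sq hv (c := (c : ℝ)) c.coe_nonneg (coe_tiltVar hv c)]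
    congr 1
    unfold tiltNorm
    congr 1
    have hv' : (0 : ℝ) < v := lt_of_le_of_ne v.coe_nonneg (fun h => hv (by exact_mod_cast h.symm))
    have hpos : (0 : ℝ) < 1 + c * v := by positivity
    rw [← Real.sqrt_inv]
    congr 1
    rw [coe_tiltVar hv c]
    field_simp

/-! ## §3 Tilting finitely many independent Gaussian modes -/

/-- **Tilting finitely many modes of `⊗_m 𝒩(0, v_m)`** by `Π_{m∈T} e^{−c_m X_m²/2}`: the result is
`(Π_{m∈T} tiltNorm(v_m,c_m))` times the product Gaussian with variances `tiltVar(v_m,c_m)` on `T`, `v_m` off `T`.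
[cite: MagnenRivasseauSeneor1993, (II.18)–(II.19) p.332 tl.16–23] -/
theorem modeGaussian_withDensity_prod {L : Type*} [DecidableEq L] (v : Momentum × L → ℝ≥0)
    (T : Finset (Momentum × L)) (c : Momentum × L → ℝ≥0) :
    (modeGaussian v).withDensity
        (fun X => ∏ m ∈ T, ENNReal.ofReal (Real.exp (-((c m : ℝ) / 2) * X m ^ 2))) =
      (∏ m ∈ T, tiltNorm (v m) (c m)) •
        modeGaussian (fun m => if m ∈ T then tiltVar (v m) (c m) else v m) := by
  have h := infinitePi_withDensity_finset_prod (fun m => gaussianReal 0 (v m))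
    (fun m => gaussianReal 0 (tiltVar (v m) (c m))) T
    (f := fun m x => ENNReal.ofReal (Real.exp (-((c m : ℝ) / 2) * x ^ 2))) (fun m => by fun_prop)
    (fun m => tiltNorm (v m) (c m)) (fun m _ => tiltNorm_ne_zero _ _) (fun m _ => tiltNorm_ne_top _ _)
    (fun m _ => gaussianReal_withDensity_exp_neg_half_mul_sq_eq_tilt (v m) (c m))
  unfold modeGaussian
  rw [h]
  congr 2
  funext m
  dsimp only
  split_ifs <;> rfl

/-! ## §4 The quadratic form `⟨A, w(p)A⟩` of a REAL configuration on a symmetric window, in independent coordinates -/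

/-- THE POSITIVE HALF of a window: the representatives of the pairs `{p, −p}` it contains (half-lattice of
`…GaussianReferenceMeasures` §1, ours). [cite: MagnenRivasseauSeneor1993, §II.A p.328 tl.12–17] -/
def posWindow (S : Finset Momentum) : Finset Momentum := S.filter Momentum.IsPos

/-- The real coordinates `(p, μ, a, Re/Im)` of a window at positive momenta — the INDEPENDENT Gaussian coordinates of
`dμ_{0,ρ₁}` the window sees. [cite: MagnenRivasseauSeneor1993, §II.A p.328 tl.12–17, (II.18) p.332] -/
def posModes (S : Finset Momentum) : Finset Mode := posWindow S ×ˢ Finset.univ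

/-- Membership in the positive half. [cite: MagnenRivasseauSeneor1993, §II.A p.328] -/
theorem mem_posWindow_iff {S : Finset Momentum} {p : Momentum} : p ∈ posWindow S ↔ p ∈ S ∧ p.IsPos :=
  Finset.mem_filter

/-- Membership in the positive coordinates. [cite: MagnenRivasseauSeneor1993, §II.A p.328] -/
theorem mem_posModes_iff {S : Finset Momentum} {m : Mode} : m ∈ posModes S ↔ m.1 ∈ S ∧ m.1.IsPos := by
  unfold posModes
  rw [Finset.mem_product, mem_posWindow_iff]
  simp

/-- A coordinate at a positive momentum is its own representative. [cite: MagnenRivasseauSeneor1993, §II.A p.328 tl.12–17] -/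
theorem rep_of_isPos {L : Type*} {m : Momentum × L} (h : m.1.IsPos) : rep m = m := if_pos h

/-- Representatives sit at positive momenta. [cite: MagnenRivasseauSeneor1993, §II.A p.328 tl.12–17] -/
theorem isPos_rep {L : Type*} (m : Momentum × L) : (rep m).1.IsPos := by
  unfold rep
  split_ifs with h
  · exact h
  · exact (Momentum.isPos_or_isPos_neg m.1).resolve_left h

/-- On a SYMMETRIC window an even summand sums to twice its sum over the positive half (`p ↦ −p` is a bijection
between the two halves). [cite: MagnenRivasseauSeneor1993, §II.A p.328 tl.12–17] -/
theorem sum_symm_window {S : Finset Momentum} (hS : ∀ p ∈ S, p.neg ∈ S) (h : Momentum → ℝ)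
    (hh : ∀ p, h p.neg = h p) : ∑ p ∈ S, h p = 2 * ∑ p ∈ posWindow S, h p := by
  rw [← Finset.sum_filter_add_sum_filter_not S Momentum.IsPos, two_mul]
  unfold posWindow
  congr 1
  refine Finset.sum_nbij' (fun p => p.neg) (fun p => p.neg) ?_ ?_ ?_ ?_ ?_
  · intro p hp
    rw [Finset.mem_filter] at hp ⊢
    exact ⟨hS p hp.1, (Momentum.isPos_or_isPos_neg p).resolve_left hp.2⟩
  · intro q hq
    rw [Finset.mem_filter] at hq ⊢
    exact ⟨hS q hq.1, Momentum.not_isPos_neg_of_isPos hq.2⟩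
  · intro p _
    exact Momentum.neg_neg p
  · intro q _
    exact Momentum.neg_neg q
  · intro p _
    exact (hh p).symm

/-- `Σ_{μ,a} |Ã^a_μ(p)|²` of a realified configuration in the independent coordinates: `Σ_ℓ X(rep(p,ℓ))²`.
[cite: MagnenRivasseauSeneor1993, §II.A p.328 tl.12–17] -/
theorem sum_normSq_coeff_realify (X : Config) (p : Momentum) :
    ∑ μ, ∑ a, normSq (coeff (realify modeIm X) p μ a) = ∑ ℓ : Fin 4 × Fin 3 × Bool, X (rep (p, ℓ)) ^ 2 := by
  simp_rw [normSq_coeff, realify_sq]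
  simp only [Fintype.sum_prod_type, Fintype.sum_bool]
  exact Finset.sum_congr rfl fun μ _ => Finset.sum_congr rfl fun a _ => add_comm _ _

/-- **`⟨A, w(p)A⟩` OF A REAL FIELD ON A SYMMETRIC WINDOW, IN INDEPENDENT COORDINATES.** For an even symbol `w` and a
window closed under `p ↦ −p`, `(1/2)Σ_{p∈S} w(p) Σ_{μ,a}|Ã^a_μ(p)|² = Σ_{m∈posModes S} w(p_m) X_m²` for the realified
configuration `A` of the coordinates `X`: the two members of each pair `±p` contribute the same (`Ã(−p) = conj Ã(p)`),
which eats the printed «factor 1/2 in component notation». [cite: MagnenRivasseauSeneor1993, p.328 tl.12–17 and tl.37–41, (II.19) p.332] -/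
theorem quadForm_realify {S : Finset Momentum} (hS : ∀ p ∈ S, p.neg ∈ S) {w : Momentum → ℝ}
    (hw : ∀ p, w p.neg = w p) (X : Config) :
    quadForm S w (realify modeIm X) = ∑ m ∈ posModes S, w m.1 * X m ^ 2 := by
  unfold quadForm
  simp_rw [sum_normSq_coeff_realify]
  rw [sum_symm_window hS (fun p => w p * ∑ ℓ : Fin 4 × Fin 3 × Bool, X (rep (p, ℓ)) ^ 2) ?_]
  · unfold posModes
    rw [Finset.sum_product, ← mul_assoc, show (1 / 2 : ℝ) * 2 = 1 by norm_num, one_mul]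
    refine Finset.sum_congr rfl fun p hp => ?_
    rw [Finset.mul_sum]
    refine Finset.sum_congr rfl fun ℓ _ => ?_
    rw [rep_of_isPos (m := (p, ℓ)) (mem_posWindow_iff.mp hp).2]
  · intro p
    simp only [hw p, rep_neg]

/-- Hence the tilt factor of a real field is a finite product of one-coordinate factors:
`e^{−(1/2)⟨A,w(p)A⟩_S} = Π_{m∈posModes S} e^{−w(p_m)X_m²/2}`. [cite: MagnenRivasseauSeneor1993, (II.18) p.332 tl.16–19] -/
theorem exp_neg_half_quadForm_realify {S : Finset Momentum} (hS : ∀ p ∈ S, p.neg ∈ S) {w : Momentum → ℝ}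
    (hw : ∀ p, w p.neg = w p) (X : Config) :
    ENNReal.ofReal (Real.exp (-(1 / 2) * quadForm S w (realify modeIm X))) =
      ∏ m ∈ posModes S, ENNReal.ofReal (Real.exp (-(w m.1 / 2) * X m ^ 2)) := by
  rw [quadForm_realify hS hw, Finset.mul_sum, Real.exp_sum,
    ENNReal.ofReal_prod_of_nonneg fun _ _ => (Real.exp_pos _).le]
  refine Finset.prod_congr rfl fun m _ => ?_
  congr 2
  ring

/-! ## §5 Tilting a real Gaussian field law by `e^{−(1/2)⟨A, w(p)A⟩}` -/

/-- The realified law sees the variances at the REPRESENTATIVES only: two variance profiles that agree at positive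
momenta give the same real Gaussian field. [cite: MagnenRivasseauSeneor1993, §II.A p.328 tl.12–17, (II.18) p.332] -/
theorem gaussianFieldLaw_congr_of_isPos {L : Type*} (im : L → Bool) {v₁ v₂ : Momentum × L → ℝ≥0}
    (h : ∀ m : Momentum × L, m.1.IsPos → v₁ m = v₂ m) : gaussianFieldLaw im v₁ = gaussianFieldLaw im v₂ := by
  let P : Set (Momentum × L) := {m | m.1.IsPos}
  let R : (P → ℝ) → (Momentum × L → ℝ) := fun Y m => sgn im m * Y ⟨rep m, isPos_rep m⟩
  have hR : Measurable R := measurable_pi_lambda _ fun m => measurable_const.mul (measurable_pi_apply _)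
  have hres : Measurable (P.restrict : (Momentum × L → ℝ) → (P → ℝ)) :=
    measurable_pi_lambda _ fun i => measurable_pi_apply _
  have hfac : realify im = R ∘ P.restrict := by
    funext Y m
    rfl
  have key : ∀ v : Momentum × L → ℝ≥0, gaussianFieldLaw im v =
      (Measure.infinitePi fun i : P => gaussianReal 0 (v i)).map R := by
    intro v
    unfold gaussianFieldLaw modeGaussian
    rw [hfac, ← Measure.map_map hR hres, Measure.infinitePi_map_restrict']
  rw [key, key]
  congr 2
  funext i
  rw [h i i.2]

variable (S : Finset Momentum)

/-- **TILTING A REAL GAUSSIAN FIELD BY `e^{−(1/2)⟨A, w(p)A⟩_S}`** («joining to the propagator the quadratic piece»): for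
mode variances `v`, an even nonnegative symbol `w` and a symmetric window `S`, the tilted law is
`(Π_{m∈posModes S} tiltNorm(v_m, w(p_m)))` times the real Gaussian field law with variances `tiltVar(v_m, w(p_m))` on the
window and `v_m` off it. [cite: MagnenRivasseauSeneor1993, (II.18)–(II.19) p.332 tl.16–23] -/
theorem gaussianFieldLaw_withDensity_exp_neg_half_quadForm (hS : ∀ p ∈ S, p.neg ∈ S) (v : Mode → ℝ≥0)
    {w : Momentum → ℝ≥0} (hw : ∀ p, w p.neg = w p) :
    (gaussianFieldLaw modeIm v).withDensity
        (fun A => ENNReal.ofReal (Real.exp (-(1 / 2) * quadForm S (fun p => (w p : ℝ)) A))) =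
      (∏ m ∈ posModes S, tiltNorm (v m) (w m.1)) •
        gaussianFieldLaw modeIm (fun m => if m.1 ∈ S then tiltVar (v m) (w m.1) else v m) := by
  have hF : Measurable fun A : Config =>
      ENNReal.ofReal (Real.exp (-(1 / 2) * quadForm S (fun p => (w p : ℝ)) A)) :=
    ENNReal.measurable_ofReal.comp (Real.measurable_exp.comp
      ((continuous_quadForm S _).measurable.const_mul _))
  have hw' : ∀ p, (w p.neg : ℝ) = w p := fun p => by rw [hw p]
  have hcomp : (fun A : Config => ENNReal.ofReal (Real.exp (-(1 / 2) * quadForm S (fun p => (w p : ℝ)) A))) ∘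
      realify modeIm = fun X => ∏ m ∈ posModes S, ENNReal.ofReal (Real.exp (-((w m.1 : ℝ) / 2) * X m ^ 2)) := by
    funext X
    exact exp_neg_half_quadForm_realify hS hw' X
  unfold gaussianFieldLaw
  rw [withDensity_map_eq _ (measurable_realify modeIm) hF, hcomp, modeGaussian_withDensity_prod,
    Measure.map_smul]
  congr 1
  refine gaussianFieldLaw_congr_of_isPos modeIm fun m hm => ?_
  by_cases hmS : m.1 ∈ S
  · rw [if_pos (mem_posModes_iff.mpr ⟨hmS, hm⟩), if_pos hmS]
  · rw [if_neg (fun h' => hmS (mem_posModes_iff.mp h').1), if_neg hmS]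

/-! ## §6 `dμ_{axial,ρ₁}` on a window and (II.18) as an identity of measures on `Config` -/

/-- The symbol `p₀²` of `⟨A, p₀²A⟩`, as a nonnegative real. [cite: MagnenRivasseauSeneor1993, (II.9) p.330, (II.19) p.332] -/
def cTime (p : Momentum) : ℝ≥0 := ⟨((p.1 0 : ℤ) : ℝ) ^ 2, sq_nonneg _⟩

/-- Its value. [cite: MagnenRivasseauSeneor1993, (II.19) p.332] -/
@[simp] theorem coe_cTime (p : Momentum) : ((cTime p : ℝ≥0) : ℝ) = ((p.1 0 : ℤ) : ℝ) ^ 2 := rfl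

/-- `p₀²` is even. [cite: MagnenRivasseauSeneor1993, §II.A p.328] -/
theorem cTime_neg (p : Momentum) : cTime p.neg = cTime p := by
  apply NNReal.eq
  simp [cTime]

/-- `⟨A, p₀²A⟩` is the quadratic form of the symbol `cTime`. [cite: MagnenRivasseauSeneor1993, (II.19) p.332] -/
theorem quadTime_eq_quadForm_cTime (A : Config) :
    quadTime S A = quadForm S (fun p => ((cTime p : ℝ≥0) : ℝ)) A := rfl

namespace Parameters

variable (par : Parameters)

/-- **THE MODE VARIANCES OF `dμ_{axial,ρ₁}` on the window `S`** — «obtained by joining to C₀ the quadratic piece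
⟨A, p₀²A⟩»: on the window, the variance `v = C₀(p)κ_{ρ₁}(|p|)` of `dμ_{0,ρ₁}` (spatial labels; `0` for time labels)
becomes `v/(1 + p₀²v)` (`= (p₀² + v⁻¹)⁻¹` for `v > 0`; READING (U)); off the window nothing changes.
[cite: MagnenRivasseauSeneor1993, (II.18)–(II.19) p.332 tl.18–23] -/
def axialVariance (ρ₁ : ℕ) (S : Finset Momentum) (m : Mode) : ℝ≥0 :=
  if m.1 ∈ S then tiltVar (par.muZeroVariance ρ₁ m) (cTime m.1) else par.muZeroVariance ρ₁ m

/-- Off the window the variances are those of `dμ_{0,ρ₁}`. [cite: MagnenRivasseauSeneor1993, (II.18) p.332] -/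
theorem axialVariance_of_not_mem (ρ₁ : ℕ) {S : Finset Momentum} {m : Mode} (hm : m.1 ∉ S) :
    par.axialVariance ρ₁ S m = par.muZeroVariance ρ₁ m := if_neg hm

/-- On the window they are the tilted ones. [cite: MagnenRivasseauSeneor1993, (II.19) p.332] -/
theorem axialVariance_of_mem (ρ₁ : ℕ) {S : Finset Momentum} {m : Mode} (hm : m.1 ∈ S) :
    par.axialVariance ρ₁ S m = tiltVar (par.muZeroVariance ρ₁ m) (cTime m.1) := if_pos hm

/-- **`dμ_{axial,ρ₁}` is still axial**: the time components keep variance `0` (`A₀ = 0`, (II.7)).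
[cite: MagnenRivasseauSeneor1993, (II.7) p.329, (II.18) p.332] -/
theorem axialVariance_of_isTime (ρ₁ : ℕ) (S : Finset Momentum) {m : Mode} (h : m.IsTime) :
    par.axialVariance ρ₁ S m = 0 := by
  unfold axialVariance
  rw [par.muZeroVariance_of_isTime ρ₁ h]
  split_ifs <;> simp

/-- The axial variances never exceed those of `dμ_{0,ρ₁}`. [cite: MagnenRivasseauSeneor1993, (II.19) p.332] -/
theorem axialVariance_le (ρ₁ : ℕ) (S : Finset Momentum) (m : Mode) :
    par.axialVariance ρ₁ S m ≤ par.muZeroVariance ρ₁ m := by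
  unfold axialVariance
  split_ifs
  · exact tiltVar_le _ _
  · exact le_rfl

end Parameters

variable (par : Parameters)

/-- On a symmetric window the axial variances are even under `p ↦ −p` (`v(rep m) = v(m)`).
[cite: MagnenRivasseauSeneor1993, (II.18)–(II.19) p.332] -/
theorem axialVariance_rep (hS : ∀ p ∈ S, p.neg ∈ S) (ρ₁ : ℕ) (m : Mode) :
    par.axialVariance ρ₁ S (rep m) = par.axialVariance ρ₁ S m := by
  unfold Parameters.axialVariance
  rw [muZeroVariance_rep]
  by_cases hpos : m.1.IsPos
  · rw [rep_of_isPos hpos]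
  · have hrep : rep m = (m.1.neg, m.2) := if_neg hpos
    have hiff : m.1.neg ∈ S ↔ m.1 ∈ S := ⟨fun h => by simpa using hS _ h, fun h => hS _ h⟩
    rw [hrep]
    simp only [cTime_neg, hiff]

/-- **`dμ_{axial,ρ₁}(A)`** on the window `S`: the real Gaussian field law with the axial variances (READING (U)).
[cite: MagnenRivasseauSeneor1993, (II.18) p.332 tl.18–21] -/
def muAxial (ρ₁ : ℕ) : Measure Config := gaussianFieldLaw modeIm (par.axialVariance ρ₁ S)

/-- It is a probability measure. [cite: MagnenRivasseauSeneor1993, (II.18) p.332] -/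
instance muAxial.isProbabilityMeasure (ρ₁ : ℕ) : IsProbabilityMeasure (muAxial S par ρ₁) := by
  unfold muAxial; infer_instance

/-- **THE PROPORTIONALITY CONSTANT of (II.18)** on the window `S`: `Z = Π_{m∈posModes S} (1 + p₀(m)² v_m)^{−1/2}` over
the independent coordinates of the window. [cite: MagnenRivasseauSeneor1993, (II.18) p.332 tl.18–19] -/
def axialNorm (ρ₁ : ℕ) : ℝ≥0∞ := ∏ m ∈ posModes S, tiltNorm (par.muZeroVariance ρ₁ m) (cTime m.1)

/-- `Z ≠ 0`. [cite: MagnenRivasseauSeneor1993, (II.18) p.332] -/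
theorem axialNorm_ne_zero (ρ₁ : ℕ) : axialNorm S par ρ₁ ≠ 0 :=
  Finset.prod_ne_zero_iff.mpr fun _ _ => tiltNorm_ne_zero _ _

/-- `Z < ∞`. [cite: MagnenRivasseauSeneor1993, (II.18) p.332] -/
theorem axialNorm_ne_top (ρ₁ : ℕ) : axialNorm S par ρ₁ ≠ ⊤ :=
  ENNReal.prod_ne_top fun _ _ => tiltNorm_ne_top _ _

/-- `Z ≤ 1`. [cite: MagnenRivasseauSeneor1993, (II.18) p.332] -/
theorem axialNorm_le_one (ρ₁ : ℕ) : axialNorm S par ρ₁ ≤ 1 :=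
  Finset.prod_le_one' fun _ _ => tiltNorm_le_one _ _

/-- **(II.18)/(II.19) AS MEASURES — THE WINDOW-PRODUCT ASSEMBLY.** On every symmetric momentum window `S` and for every
fake cutoff `ρ₁`: `dμ_{0,ρ₁}(A) · e^{−(1/2)⟨A,p₀²A⟩_S} = Z · dμ_{axial,ρ₁}(A)` as measures on `Config`, with
`Z = axialNorm S par ρ₁` and `dμ_{axial,ρ₁} = muAxial S par ρ₁` («which is proportional to dμ_{axial,ρ₁}(A) … obtained
by joining to C₀ the quadratic piece ⟨A, p₀²A⟩»). [cite: MagnenRivasseauSeneor1993, (II.18)–(II.19) p.332 tl.16–23] -/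
theorem muZero_withDensity_exp_neg_half_quadTime (hS : ∀ p ∈ S, p.neg ∈ S) (ρ₁ : ℕ) :
    (muZero par ρ₁).withDensity (fun A => ENNReal.ofReal (Real.exp (-(1 / 2) * quadTime S A))) =
      axialNorm S par ρ₁ • muAxial S par ρ₁ := by
  unfold muZero muAxial axialNorm Parameters.axialVariance
  simp_rw [quadTime_eq_quadForm_cTime]
  exact gaussianFieldLaw_withDensity_exp_neg_half_quadForm S hS _ cTime_neg

/-- **The constant IS the integral**: `∫ e^{−(1/2)⟨A,p₀²A⟩_S} dμ_{0,ρ₁}(A) = Z` (so `0 < Z ≤ 1`: this factor, unlike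
the positive exponential of `…AxialYMAction` §7, is harmless). [cite: MagnenRivasseauSeneor1993, (II.18) p.332 tl.16–19] -/
theorem lintegral_exp_neg_half_quadTime_muZero (hS : ∀ p ∈ S, p.neg ∈ S) (ρ₁ : ℕ) :
    ∫⁻ A, ENNReal.ofReal (Real.exp (-(1 / 2) * quadTime S A)) ∂(muZero par ρ₁) = axialNorm S par ρ₁ := by
  have h := congrArg (fun ν : Measure Config => ν Set.univ)
    (muZero_withDensity_exp_neg_half_quadTime S par hS ρ₁)
  simp only [withDensity_apply _ MeasurableSet.univ, Measure.restrict_univ, Measure.smul_apply, smul_eq_mul,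
    measure_univ, mul_one] at h
  exact h

/-- **(II.18) AS PRINTED, as an identity of measures on `Config`.** On every symmetric window `S`, for every coupling
inside `F_sp` and every fake cutoff `ρ₁`:
`dμ_{0,ρ₁}(A) e^{(1/2)(−F²_sp−⟨A,p₀²A⟩+Σ_i(λ_i^t)²⟨A,(p²κ^i(p))A⟩)} = Z · dμ_{axial,ρ₁}(A) e^{(1/2)(−F²_sp+Σ_i(λ_i^t)²⟨A,(p²κ^i(p))A⟩)}`
(the left density is the third factor `ymFactor` of (II.78); an identity between measures on `Config`, finite or not
— `…AxialYMAction` §7 shows that the positive exponential `e^{(1/2)Σ_i(λ_i^t)²⟨A,(p²κ^i(p))A⟩}` alone is not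
`dμ_{0,ρ₁}`-integrable, «This formula is still formal»; the finiteness of the full right-hand side is not decided here).
[cite: MagnenRivasseauSeneor1993, (II.18) p.332 tl.16–21, (II.78) p.347 tl.2–7] -/
theorem muZero_withDensity_ymFactor (hS : ∀ p ∈ S, p.neg ∈ S) (lam : ℝ) (ρ₁ : ℕ) :
    (muZero par ρ₁).withDensity (fun A => ENNReal.ofReal (ymFactor S par lam ρ₁ A)) =
      axialNorm S par ρ₁ • (muAxial S par ρ₁).withDensity
        (fun A => ENNReal.ofReal (Real.exp ((1 / 2) * (-Fsp S lam A + quadSlices S par ρ₁ A)))) := by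
  have hm1 : Measurable fun A : Config => ENNReal.ofReal (Real.exp (-(1 / 2) * quadTime S A)) := by
    simp_rw [quadTime_eq_quadForm]
    exact ENNReal.measurable_ofReal.comp (Real.measurable_exp.comp
      ((continuous_quadForm S _).measurable.const_mul _))
  have hm2 : Measurable fun A : Config =>
      ENNReal.ofReal (Real.exp ((1 / 2) * (-Fsp S lam A + quadSlices S par ρ₁ A))) :=
    ENNReal.measurable_ofReal.comp (Real.measurable_exp.comp
      (((continuous_Fsp S lam).neg.add (continuous_quadSlices S par ρ₁)).measurable.const_mul _))
  have hsplit : (fun A : Config => ENNReal.ofReal (ymFactor S par lam ρ₁ A)) =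
      (fun A => ENNReal.ofReal (Real.exp (-(1 / 2) * quadTime S A))) *
        fun A => ENNReal.ofReal (Real.exp ((1 / 2) * (-Fsp S lam A + quadSlices S par ρ₁ A))) := by
    funext A
    simp only [Pi.mul_apply, ymFactor, bareExponent]
    rw [← ENNReal.ofReal_mul (Real.exp_pos _).le, ← Real.exp_add]
    congr 1
    ring
  rw [hsplit, withDensity_mul _ hm1 hm2, muZero_withDensity_exp_neg_half_quadTime S par hS ρ₁,
    withDensity_smul_measure]

/-! ## §7 (II.19) for the assembled measure: `C_axial(p)⁻¹ = p₀² + C₀(p)⁻¹` on the plateau; the two-point function -/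

/-- **(II.19) FOR `dμ_{axial,ρ₁}`.** On a spatial coordinate of the window on the plateau of the fake cutoff
(`κ_{ρ₁}(|p|) = 1`) with `C₀(p)⁻¹ > 0`, the variance of `dμ_{axial,ρ₁}` is `(p₀² + C₀(p)⁻¹)⁻¹ = C_axial(p)` — the
printed `⟨A, p₀²A⟩ + Σ_i(λ_i^t)²⟨Ap²κ^i(p)A⟩ = ⟨A, C_axial⁻¹A⟩`. [cite: MagnenRivasseauSeneor1993, (II.19) p.332 tl.21–23] -/
theorem axialVariance_eq_inv_invCaxial (ρ₁ : ℕ) {m : Mode} (hmS : m.1 ∈ S) (hμ : ¬ m.IsTime)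
    (hκ : par.uvCutoff ρ₁ m.1.norm = 1) (hC₀ : 0 < par.invC0 ρ₁ m.1.norm) :
    ((par.axialVariance ρ₁ S m : ℝ≥0) : ℝ) = (((m.1.1 0 : ℤ) : ℝ) ^ 2 + par.invC0 ρ₁ m.1.norm)⁻¹ := by
  have hv : ((par.muZeroVariance ρ₁ m : ℝ≥0) : ℝ) = (par.invC0 ρ₁ m.1.norm)⁻¹ := by
    unfold Parameters.muZeroVariance
    rw [if_neg hμ]
    unfold Parameters.muZeroCovariance
    rw [hκ, one_mul, Real.coe_toNNReal _ (inv_nonneg.mpr hC₀.le)]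
  have hv0 : par.muZeroVariance ρ₁ m ≠ 0 := by
    intro h
    rw [h, NNReal.coe_zero] at hv
    exact (inv_pos.mpr hC₀).ne' hv.symm
  rw [par.axialVariance_of_mem ρ₁ hmS, coe_tiltVar hv0, hv, inv_inv, coe_cTime, add_comm]

/-- … and that is the tree's symbol `Ansatz.invCaxial` of `…StartingAnsatz` §6, inverted (nonnegative squared
couplings, `λ_i^t = √((λ_i^t)²)`). [cite: MagnenRivasseauSeneor1993, (II.19) p.332 tl.21–23] -/
theorem axialVariance_eq_inv_ansatz (ρ₁ : ℕ) {m : Mode} (hmS : m.1 ∈ S) (hμ : ¬ m.IsTime)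
    (hκ : par.uvCutoff ρ₁ m.1.norm = 1) (hC₀ : 0 < par.invC0 ρ₁ m.1.norm)
    (hlam : ∀ i, 0 ≤ par.tentativeCoupling i) :
    ((par.axialVariance ρ₁ S m : ℝ≥0) : ℝ) =
      (Ansatz.invCaxial par.τ par.η par.M (fun i => Real.sqrt (par.tentativeCoupling i)) ρ₁
        ((m.1.1 0 : ℤ) : ℝ) (m.1.norm ^ 2))⁻¹ := by
  rw [axialVariance_eq_inv_invCaxial S par ρ₁ hmS hμ hκ hC₀]
  unfold Ansatz.invCaxial
  rw [par.invC0_eq_ansatz ρ₁ m.1.norm_nonneg hlam]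

/-- (v1.1) Hence on the whole plateau `|p| ≤ M^{ρ₁}` of the fake cutoff (where `κ_{ρ₁} = 1`,
`Parameters.uvCutoff_eq_one_and_zero`) the spatial modes of the window carry the printed `C_axial(p) = (p₀² + C₀(p)⁻¹)⁻¹`.
[cite: MagnenRivasseauSeneor1993, (II.19) p.332 tl.21–23, (II.13)–(II.14) p.331] -/
theorem axialVariance_eq_inv_invCaxial_of_le (ρ₁ : ℕ) {m : Mode} (hmS : m.1 ∈ S) (hμ : ¬ m.IsTime)
    (hplateau : m.1.norm ≤ (par.M : ℝ) ^ ρ₁) (hC₀ : 0 < par.invC0 ρ₁ m.1.norm) :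
    ((par.axialVariance ρ₁ S m : ℝ≥0) : ℝ) = (((m.1.1 0 : ℤ) : ℝ) ^ 2 + par.invC0 ρ₁ m.1.norm)⁻¹ :=
  axialVariance_eq_inv_invCaxial S par ρ₁ hmS hμ ((par.uvCutoff_eq_one_and_zero ρ₁).1 hplateau) hC₀

/-- (v1.1) Beyond the fake cutoff, `|p| ≥ (3 + η⁻¹)M^{ρ₁}`, the modes are dead under `dμ_{axial,ρ₁}` as under `dμ_{0,ρ₁}`
(`muZeroCovariance_eq_zero_of_ge`: variance `0`, and a Dirac mode stays Dirac).
[cite: MagnenRivasseauSeneor1993, (II.13)–(II.14) p.331, (II.18) p.332] -/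
theorem axialVariance_eq_zero_of_ge (ρ₁ : ℕ) {m : Mode} (h : (3 + par.η⁻¹) * (par.M : ℝ) ^ ρ₁ ≤ m.1.norm) :
    par.axialVariance ρ₁ S m = 0 := by
  have hv : par.muZeroVariance ρ₁ m = 0 := by
    unfold Parameters.muZeroVariance
    split_ifs
    · rfl
    · rw [par.muZeroCovariance_eq_zero_of_ge ρ₁ h, Real.toNNReal_zero]
  unfold Parameters.axialVariance
  rw [hv]
  split_ifs <;> simp

/-- The canonical windows are symmetric, so all of the above applies to `window R`.
[cite: MagnenRivasseauSeneor1993, (II.13)–(II.14) p.331, (II.18) p.332] -/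
theorem window_symm (R : ℝ) : ∀ p ∈ window R, p.neg ∈ window R :=
  fun p hp => (neg_mem_window_iff R p).mpr hp

/-- **(II.18) on the canonical window** `window ((3 + η⁻¹)M^{ρ₁})` of all modes `dμ_{0,ρ₁}` can excite.
[cite: MagnenRivasseauSeneor1993, (II.18)–(II.19) p.332 tl.16–23, (II.13)–(II.14) p.331] -/
theorem muZero_withDensity_exp_neg_half_quadTime_canonical (ρ₁ : ℕ) :
    (muZero par ρ₁).withDensity (fun A => ENNReal.ofReal (Real.exp (-(1 / 2) *
      quadTime (window ((3 + par.η⁻¹) * (par.M : ℝ) ^ ρ₁)) A))) =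
      axialNorm (window ((3 + par.η⁻¹) * (par.M : ℝ) ^ ρ₁)) par ρ₁ •
        muAxial (window ((3 + par.η⁻¹) * (par.M : ℝ) ^ ρ₁)) par ρ₁ :=
  muZero_withDensity_exp_neg_half_quadTime _ par (window_symm _) ρ₁

/-- **THE TWO-POINT FUNCTION OF `dμ_{axial,ρ₁}`** (symmetric window): `∫ Ã_m Ã_{m′} dμ_{axial,ρ₁} = 0` unless `m, m′` have
the same representative, and then `± axialVariance ρ₁ S m` — diagonal in the labels, translation invariant, with the
axial propagator. [cite: MagnenRivasseauSeneor1993, (II.18)–(II.19) p.332] -/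
theorem integral_mul_muAxial (hS : ∀ p ∈ S, p.neg ∈ S) (ρ₁ : ℕ) (m m' : Mode) :
    ∫ A, A m * A m' ∂(muAxial S par ρ₁) =
      if rep m = rep m' then sgn modeIm m * sgn modeIm m' * (par.axialVariance ρ₁ S m : ℝ) else 0 := by
  unfold muAxial
  split_ifs with h
  · rw [integral_mul_gaussianFieldLaw_of_rep_eq modeIm _ h, axialVariance_rep S par hS]
  · exact integral_mul_gaussianFieldLaw_of_rep_ne modeIm _ h

/-- In particular `∫ Ã_m² dμ_{axial,ρ₁} = axialVariance ρ₁ S m`. [cite: MagnenRivasseauSeneor1993, (II.19) p.332] -/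
theorem integral_sq_muAxial (hS : ∀ p ∈ S, p.neg ∈ S) (ρ₁ : ℕ) (m : Mode) :
    ∫ A, A m ^ 2 ∂(muAxial S par ρ₁) = par.axialVariance ρ₁ S m := by
  have h := integral_mul_muAxial S par hS ρ₁ m m
  rw [if_pos rfl] at h
  simp_rw [← sq] at h
  rw [h, sgn_sq, one_mul]

/-! ## §7b (v1.1) The axial reference model: the pinned interface inhabited by `dμ_{axial,ρ₁(ρ)}`, with UV limit -/

/-- A monomial containing a time coordinate has expectation `0` under `dμ_{axial,ρ₁}` (still axial).
[cite: MagnenRivasseauSeneor1993, (II.7) p.329, (II.18) p.332] -/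
theorem integral_monomial_muAxial_eq_zero_of_time (hS : ∀ p ∈ S, p.neg ∈ S) (ρ₁ : ℕ) {N : ℕ}
    (f : Fin N → Mode) (h : ∃ j, (f j).IsTime) : ∫ A, monomial f A ∂(muAxial S par ρ₁) = 0 := by
  obtain ⟨j, hj⟩ := h
  rw [monomial_eq_gmonomial, muAxial, integral_gmonomial_gaussianFieldLaw,
    integral_gmonomial_modeGaussian_eq_zero (rep ∘ f) (j₀ := j) ?_, mul_zero]
  show par.axialVariance ρ₁ S (rep (f j)) = 0
  rw [axialVariance_rep S par hS]
  exact par.axialVariance_of_isTime ρ₁ S hj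

/-- The canonical window of the fake cutoff `ρ₁`: all modes `dμ_{0,ρ₁}` can excite, `|p| < (3 + η⁻¹)M^{ρ₁}`.
[cite: MagnenRivasseauSeneor1993, (II.13)–(II.14) p.331, (II.18) p.332] -/
def Parameters.canonicalWindow (ρ₁ : ℕ) : Finset Momentum := window ((3 + par.η⁻¹) * (par.M : ℝ) ^ ρ₁)

/-- **The AXIAL reference model**: the pinned interface `PinnedTheory` of `…MainStatementPinned` inhabited by
`⟨·⟩_{ax,ρ} := dμ_{axial,ρ₁(ρ)}(A)` on the canonical window of `ρ₁(ρ)` — the free axial-gauge Gaussian of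
(II.18)/(II.19) at the fake cutoff of the named parameters; Ward data and `E_N` free. HONEST STATUS: a free
(Gaussian) field, NOT MRS's interacting measure (the other factors of (II.78) are not typed), exhibited to show what the
printed predicate constrains, as `gaussianRefModel` of `…GaussianReferenceMeasures` was.
[cite: MagnenRivasseauSeneor1993, (II.18)–(II.19) p.332, p.327 tl.39–43] -/
def axialRefModel (WTest : ℕ → Type) (wardData : (N : ℕ) → WTest N → WardData)
    (E : (N : ℕ) → WTest N → ℝ) : PinnedTheory where
  par := par
  law ρ := muAxial (par.canonicalWindow (par.ρ₁ ρ)) par (par.ρ₁ ρ)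
  isProb _ := inferInstance
  integrable _ _ f := integrable_gmonomial_gaussianFieldLaw _ _ f
  axial ρ _ f h := integral_monomial_muAxial_eq_zero_of_time _ par (window_symm _) (par.ρ₁ ρ) f h
  WTest := WTest
  wardData := wardData
  E := E

/-- Its two-point function on the diagonal is the axial propagator of the window.
[cite: MagnenRivasseauSeneor1993, (II.19) p.332] -/
theorem axialRefModel_schwinger_two (WTest : ℕ → Type) (wardData : (N : ℕ) → WTest N → WardData)
    (E : (N : ℕ) → WTest N → ℝ) (ρ : ℕ) (m : Mode) :
    (axialRefModel par WTest wardData E).schwinger ρ 2 ![m, m] =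
      par.axialVariance (par.ρ₁ ρ) (par.canonicalWindow (par.ρ₁ ρ)) m := by
  unfold PinnedTheory.schwinger axialRefModel
  have e1 : (fun A : Config => monomial ![m, m] A) = fun A => A m ^ 2 := by
    funext A; simp [monomial, Fin.prod_univ_two, sq]
  simp only [e1]
  exact integral_sq_muAxial _ par (window_symm _) (par.ρ₁ ρ) m

/-- The limiting axial variances: the reference limit `muZeroVarianceLim` tilted by `p₀²`.
[cite: MagnenRivasseauSeneor1993, (II.19) p.332] -/
def Parameters.axialVarianceLim (m : Mode) : ℝ≥0 := tiltVar (par.muZeroVarianceLim m) (cTime m.1)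

/-- Every mode is eventually inside the canonical window of `ρ₁(ρ)` (`ρ₁(ρ) > ρ`).
[cite: MagnenRivasseauSeneor1993, (II.13) p.331, p.340 tl.15 («ρ ≪ ρ₂ ≪ ρ₁»)] -/
theorem eventually_mem_canonicalWindow (m : Mode) :
    ∀ᶠ ρ in atTop, m.1 ∈ par.canonicalWindow (par.ρ₁ ρ) := by
  refine eventually_atTop.mpr ⟨stableIndex m, fun ρ hρ => ?_⟩
  have hρ₁ : stableIndex m ≤ par.ρ₁ ρ := by
    have h1 := (par.hρ ρ).1
    have h2 := (par.hρ ρ).2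
    omega
  have hM1 : (1 : ℝ) ≤ par.M := par.one_lt_M.le
  have hη : 0 < par.η⁻¹ := inv_pos.mpr par.hη
  have hpow : (0 : ℝ) < (par.M : ℝ) ^ par.ρ₁ ρ := by positivity
  unfold Parameters.canonicalWindow
  rw [mem_window_iff]
  calc m.1.norm ≤ (par.M : ℝ) ^ stableIndex m := norm_le_pow_stableIndex par m
    _ ≤ (par.M : ℝ) ^ par.ρ₁ ρ := pow_le_pow_right₀ hM1 hρ₁
    _ < (3 + par.η⁻¹) * (par.M : ℝ) ^ par.ρ₁ ρ := by nlinarith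

/-- MODE-WISE THE AXIAL VARIANCES ARE EVENTUALLY CONSTANT along `ρ ↦ ρ₁(ρ)`.
[cite: MagnenRivasseauSeneor1993, (II.13)–(II.19) pp.331–332] -/
theorem axialVariance_eventually_eq (m : Mode) :
    ∀ᶠ ρ in atTop, par.axialVariance (par.ρ₁ ρ) (par.canonicalWindow (par.ρ₁ ρ)) m = par.axialVarianceLim m := by
  filter_upwards [muZeroVariance_eventually_eq par m, eventually_mem_canonicalWindow par m] with ρ h1 h2
  unfold Parameters.axialVarianceLim
  rw [par.axialVariance_of_mem _ h2, h1]

/-- **The ultraviolet limit of the axial reference model EXISTS**: every moment of `dμ_{axial,ρ₁(ρ)}` converges as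
`ρ → ∞` (eventually constant, mode by mode). [cite: MagnenRivasseauSeneor1993, p.327 tl.39–41, (II.18)–(II.19) p.332] -/
theorem axialRefModel_uvLimit (WTest : ℕ → Type) (wardData : (N : ℕ) → WTest N → WardData)
    (E : (N : ℕ) → WTest N → ℝ) :
    UVLimitExistsPrinted (axialRefModel par WTest wardData E).toAxialTheory := by
  intro N f
  exact ⟨_, tendsto_integral_gmonomial_gaussianFieldLaw modeIm
    (fun ρ => par.axialVariance (par.ρ₁ ρ) (par.canonicalWindow (par.ρ₁ ρ)))
    par.axialVarianceLim (axialVariance_eventually_eq par) f⟩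

/-- Hence the interface is presented, for every choice of the named parameters, by a carrier whose two-point
function is the AXIAL propagator of (II.19) (on the plateau: `(p₀² + C₀(p)⁻¹)⁻¹`) and whose ultraviolet limit exists.
[cite: MagnenRivasseauSeneor1993, p.327 tl.39–41, (II.19) p.332] -/
theorem exists_pinnedTheory_axialRef :
    ∃ P : PinnedTheory, P.par = par ∧ UVLimitExistsPrinted P.toAxialTheory ∧
      ∀ ρ (m : Mode), P.schwinger ρ 2 ![m, m] = par.axialVariance (par.ρ₁ ρ) (par.canonicalWindow (par.ρ₁ ρ)) m :=
  ⟨axialRefModel par (fun _ => Unit) (fun _ _ => (0, [])) (fun _ _ => 0), rfl,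
    axialRefModel_uvLimit par _ _ _, fun ρ m => axialRefModel_schwinger_two par _ _ _ ρ m⟩

/-! ## §8 The same assembly for the TRUE-CUTOFF factor `e^{−(1/2)⟨A′,[(κ_ρ)⁻¹−1](p²)A′⟩}` of (II.78) (second line;
(II.40) p.340): the Gaussian algebra DECLARED in `…GaussianReferenceMeasures` §6 (`Parameters.trueCutoffCovariance`:
«OUR one-line Gaussian algebra … NOT a printed display») becomes a THEOREM on every symmetric window on which the true
cutoff is alive (`κ_ρ > 0`) -/

namespace Parameters

/-- THE TRUE-CUTOFF SYMBOL `[(κ_ρ(p))⁻¹ − 1]p²` of the second line of (II.78), as a real function of the momentum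
(`κ_ρ = par.uvCutoff ρ`, «p²» = `|p|²`). Where `κ_ρ(p) = 0` the print means `+∞` (the mode is suppressed), which is
not a real number (Lean's `0⁻¹ = 0` would give `−p²` there): the theorem below is stated on windows where `κ_ρ > 0`.
[cite: MagnenRivasseauSeneor1993, (II.78) p.347 tl.2–7, (II.40) p.340 tl.15–19] -/
def trueCutoffSymbol (ρ : ℕ) (p : Momentum) : ℝ := ((par.uvCutoff ρ p.norm)⁻¹ - 1) * p.norm ^ 2

/-- The fake/true cutoffs are at most `1`. [cite: MagnenRivasseauSeneor1993, (II.13)–(II.14) p.331] -/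
theorem uvCutoff_le_one (ρ : ℕ) (r : ℝ) : par.uvCutoff ρ r ≤ 1 := by
  unfold uvCutoff scaledCutoff
  exact cutoffFn_le_one _ _ _

/-- … and nonnegative. [cite: MagnenRivasseauSeneor1993, (II.13)–(II.14) p.331] -/
theorem uvCutoff_nonneg (ρ : ℕ) (r : ℝ) : 0 ≤ par.uvCutoff ρ r := by
  unfold uvCutoff scaledCutoff
  exact cutoffFn_nonneg _ _ _

/-- Where the true cutoff is alive its symbol is nonnegative (`0 < κ_ρ ≤ 1`).
[cite: MagnenRivasseauSeneor1993, (II.40) p.340, (II.78) p.347] -/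
theorem trueCutoffSymbol_nonneg (ρ : ℕ) {p : Momentum} (hκ : 0 < par.uvCutoff ρ p.norm) :
    0 ≤ par.trueCutoffSymbol ρ p :=
  mul_nonneg (sub_nonneg.mpr ((one_le_inv₀ hκ).mpr (par.uvCutoff_le_one ρ p.norm))) (sq_nonneg _)

/-- The symbol is even. [cite: MagnenRivasseauSeneor1993, (II.78) p.347] -/
theorem trueCutoffSymbol_neg (ρ : ℕ) (p : Momentum) :
    par.trueCutoffSymbol ρ p.neg = par.trueCutoffSymbol ρ p := by
  unfold trueCutoffSymbol
  rw [Momentum.norm_neg]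

/-- The propagator of `dμ_{0,ρ₁}` is nonnegative for nonnegative squared couplings.
[cite: MagnenRivasseauSeneor1993, (II.18) p.332] -/
theorem muZeroCovariance_nonneg (ρ₁ : ℕ) (hlam : ∀ i, 0 ≤ par.tentativeCoupling i) {r : ℝ} (hr : 0 ≤ r) :
    0 ≤ par.muZeroCovariance ρ₁ r :=
  mul_nonneg (par.uvCutoff_nonneg ρ₁ r) (inv_nonneg.mpr (par.invC0_nonneg' ρ₁ hlam hr))

/-- **On a live mode the tilted variance IS the declared true-cutoff symbol**: tilting the variance `C₀κ_{ρ₁}` of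
`dμ_{0,ρ₁}(A′)` by `[(κ_ρ)⁻¹ − 1]p²` gives `[(C₀κ_{ρ₁})⁻¹ + ((κ_ρ)⁻¹ − 1)p²]⁻¹ = Parameters.trueCutoffCovariance` (clipped
at `0` on both sides). [cite: MagnenRivasseauSeneor1993, (II.40) p.340, (II.49) p.342, (II.78) p.347] -/
theorem tiltVar_eq_trueCutoffVariance (ρ ρ₁ : ℕ) {m : Mode} (hκ : 0 < par.uvCutoff ρ m.1.norm)
    (hlam : ∀ i, 0 ≤ par.tentativeCoupling i) :
    tiltVar (par.muZeroVariance' ρ₁ m) (par.trueCutoffSymbol ρ m.1).toNNReal = par.trueCutoffVariance ρ ρ₁ m := by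
  have hC : 0 ≤ par.muZeroCovariance ρ₁ m.1.norm := par.muZeroCovariance_nonneg ρ₁ hlam m.1.norm_nonneg
  have hsym : 0 ≤ par.trueCutoffSymbol ρ m.1 := par.trueCutoffSymbol_nonneg ρ hκ
  unfold muZeroVariance' trueCutoffVariance trueCutoffCovariance
  by_cases h0 : par.muZeroCovariance ρ₁ m.1.norm = 0
  · rw [h0, if_pos (Or.inl rfl), Real.toNNReal_zero, tiltVar_zero_left]
  · have hpos : 0 < par.muZeroCovariance ρ₁ m.1.norm := lt_of_le_of_ne hC (Ne.symm h0)
    have hv0 : (par.muZeroCovariance ρ₁ m.1.norm).toNNReal ≠ 0 := by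
      intro h
      rw [Real.toNNReal_eq_zero] at h
      exact absurd h (not_le.mpr hpos)
    rw [if_neg (not_or.mpr ⟨h0, hκ.ne'⟩)]
    apply NNReal.eq
    have hval : ((par.muZeroCovariance ρ₁ m.1.norm)⁻¹ + par.trueCutoffSymbol ρ m.1)⁻¹ =
        ((par.muZeroCovariance ρ₁ m.1.norm)⁻¹ + ((par.uvCutoff ρ m.1.norm)⁻¹ - 1) * m.1.norm ^ 2)⁻¹ := rfl
    have hnn : 0 ≤ ((par.muZeroCovariance ρ₁ m.1.norm)⁻¹ + ((par.uvCutoff ρ m.1.norm)⁻¹ - 1) * m.1.norm ^ 2)⁻¹ := by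
      rw [← hval]
      exact inv_nonneg.mpr (add_nonneg (inv_nonneg.mpr hC) hsym)
    rw [coe_tiltVar hv0, Real.coe_toNNReal _ hpos.le, Real.coe_toNNReal _ hsym, Real.coe_toNNReal _ hnn, hval]

end Parameters

/-- The quadratic form only sees the symbol on the window. [cite: MagnenRivasseauSeneor1993, (II.16) p.332] -/
theorem quadForm_congr {w w' : Momentum → ℝ} (h : ∀ p ∈ S, w p = w' p) (A : Config) :
    quadForm S w A = quadForm S w' A := by
  unfold quadForm
  congr 1
  exact Finset.sum_congr rfl fun p hp => by rw [h p hp]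

/-- **THE FIRST TWO `A′`-FACTORS OF (II.78) AS A MEASURE — the declared Gaussian algebra of `…GaussianReferenceMeasures`
§6 PROVED.** On every symmetric window `S` on which the true cutoff is alive (`κ_ρ(|p|) > 0` for `p ∈ S`) and for
nonnegative squared couplings: `dμ_{0,ρ₁}(A′) · e^{−(1/2)⟨A′,[(κ_ρ)⁻¹−1](p²)A′⟩_S} = Z′ · (the real Gaussian field law
whose variances are Parameters.trueCutoffVariance ρ ρ₁ on the window and those of dμ_{0,ρ₁}(A′) off it)`, with
`Z′ = Π_{m∈posModes S}(1 + [(κ_ρ)⁻¹−1]p² · C₀κ_{ρ₁})^{−1/2}`. NOT claimed: the suppression of the modes where `κ_ρ = 0`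
(there the printed symbol is `+∞`, not a real density; `…GaussianReferenceMeasures` reads it as variance `0`).
[cite: MagnenRivasseauSeneor1993, (II.78) p.347 tl.2–7, (II.40) p.340 tl.15–19, (II.49) p.342] -/
theorem muZeroPrime_withDensity_exp_neg_half_trueCutoff (hS : ∀ p ∈ S, p.neg ∈ S) (ρ ρ₁ : ℕ)
    (hκ : ∀ p ∈ S, 0 < par.uvCutoff ρ p.norm) (hlam : ∀ i, 0 ≤ par.tentativeCoupling i) :
    (muZeroPrime par ρ₁).withDensity
        (fun A => ENNReal.ofReal (Real.exp (-(1 / 2) * quadForm S (par.trueCutoffSymbol ρ) A))) =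
      (∏ m ∈ posModes S, tiltNorm (par.muZeroVariance' ρ₁ m) (par.trueCutoffSymbol ρ m.1).toNNReal) •
        gaussianFieldLaw modeIm
          (fun m => if m.1 ∈ S then par.trueCutoffVariance ρ ρ₁ m else par.muZeroVariance' ρ₁ m) := by
  have hq : ∀ A, quadForm S (par.trueCutoffSymbol ρ) A =
      quadForm S (fun p => (((par.trueCutoffSymbol ρ p).toNNReal : ℝ≥0) : ℝ)) A := fun A =>
    quadForm_congr S (fun p hp => (Real.coe_toNNReal _ (par.trueCutoffSymbol_nonneg ρ (hκ p hp))).symm) A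
  simp_rw [hq]
  unfold muZeroPrime
  rw [gaussianFieldLaw_withDensity_exp_neg_half_quadForm S hS _
    (w := fun p => (par.trueCutoffSymbol ρ p).toNNReal) (fun p => by simp only [par.trueCutoffSymbol_neg])]
  congr 2
  funext m
  split_ifs with hm
  · exact par.tiltVar_eq_trueCutoffVariance ρ ρ₁ (hκ m.1 hm) hlam
  · rfl

end MainStatement

end Literature.MathematicalPhysics.QuantumFieldTheory.MagnenRivasseauSeneor1993
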